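import Mathlib
import HarnessLib
import Summits.Ventures.LatticeQCDFlow.Exactness.SUNWilsonForceGradient
import Summits.Ventures.LatticeQCDFlow.Exactness.OpenBoundaryWilsonAction
import Summits.Ventures.LatticeQCDFlow.Scoring.WeightedStapleSum

/-!
# The plaquette-weighted `SU(N)` force is the exact derivative of the weighted action along the drift: `d/dt|₀ (β/N)·S_w(e^{tX} ·_e U) = −2 Re tr (X · (β/2N)·TA(U_e R^w_e))`

HONEST FRAMING: exact (Metropolis-corrected) sampling algorithms for lattice gauge theory;
figures of merit are autocorrelation/cost numbers at stated couplings and volumes; no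
continuum-physics claim.

Venture `LatticeQCDFlow` (cell pub-lqcd), topic `Exactness`, FANOUT row 21 (`su3-base`, arm `OBC-HMC`: the engine's HMC
on a plaquette-weighted action kicks the momenta with the force built from WEIGHTED staples).  NEW WORK of the cell over
the tree (row 9's `SUNWilsonForceGradient`: the unit-weight identity `hasDerivAt_engineWilsonAction_drift`, its lemmas
`re_trace_mul_eq_re_trace_mul_suProj`, `engineForce_deriv_value`, and `HaarSteinSpecialUnitary.hasDerivAt_re_trace_exp_smul_mul`;
row 21's `Scoring/WeightedStapleSum`: `weightedStapleSum`, `weightedWilsonAction_mulSingle_sub`; `PTBCWilsonDefect`: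
`weightedWilsonAction`; `OpenBoundaryWilsonAction`: `obcAction = weightedWilsonAction (obcWeight τ)`).  The weighted twin
of row 9's file, in row 9's conventions (`(β/N)·S`, `fundamentalRep`, drift `t ↦ e^{t ι c} ·_e U`); def-free; nothing is
cited as a fact; no number.

* `engineWeightedAction_mulSingle_suExp` — along the one-link drift, for EVERY weight `w` (`L ≥ 2`):
  `(β/N)·S_w(e^{t ι c} ·_e U) = (β/N)(S_w(U) + Re tr (U_e R^w_e) − Re tr (e^{t ι c} U_e R^w_e))`, `R^w_e = R^w_e(U)` the
  weighted staple sum;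
* **`hasDerivAt_engineWeightedAction_drift`** — `N ≥ 1`, `L ≥ 2`, every `β`, `w`, `U`, `e`, `c`:
  `HasDerivAt (t ↦ (β/N)·S_w(suExp (t•c) ·_e U)) (−2 Re tr (ι c · (β/2N)·TA(U_e R^w_e(U)))) 0` — THE WEIGHTED-STAPLE
  FORCE MATRIX `(β/2N)·TA(U_e R^w_e)` IS THE EXACT GRADIENT of the weighted action for the kinetic pairing;
* **`hasDerivAt_engineObcAction_drift`** — the open-boundary instance (`w = obcWeight τ`, `S_w = S_OBC`).

NOT CLAIMED: the identification `U_e R^w_e = Ω^w_e` with the loop-sum form of `OpenBoundaryHMCForce.sunWeightedForce` (a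
one-line bridge once both files are in the tree); `L = 1`; second derivatives; floating point.
-/

noncomputable section

namespace Summit.Ventures.LatticeQCDFlow.Exactness

open MeasureTheory Set Function NormedSpace
open Literature.MathematicalPhysics.QuantumFieldTheory
open Literature.MathematicalPhysics.QuantumLattice (fundamentalRep fundamentalRep_apply continuous_fundamentalRep)
open Summit.Ventures.LatticeQCDFlow.Scoring (weightedStapleSum weightedWilsonAction_mulSingle_sub)
open scoped Matrix

/-! ## §1 The weighted action along a one-link drift -/

section Drift

variable (N : ℕ) {d L : ℕ} [NeZero L] (w : Plaquette d L → ℝ)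

/-- **The engine's weighted action along the one-link drift** `t ↦ e^{t ι c} ·_e U` (`L ≥ 2`, every weight):
`(β/N)·S_w(suExp (t•c) ·_e U) = (β/N)(S_w(U) + Re tr (U_e R^w_e) − Re tr (e^{t ι c} U_e R^w_e))`. -/
theorem engineWeightedAction_mulSingle_suExp (hL : 2 ≤ L) (β : ℝ)
    (U : GaugeConfig d L (Matrix.specialUnitaryGroup (Fin N) ℂ)) (e : Edge d L) (c : SUNCoords N) (t : ℝ) :
    β / N * weightedWilsonAction w (fundamentalRep (Fin N))
        (Pi.mulSingle e (suExp (sunCoordι N) (sunCoordι_skew N) (t • c)) * U) =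
      β / N * (weightedWilsonAction w (fundamentalRep (Fin N)) U +
        ((((U e : Matrix.specialUnitaryGroup (Fin N) ℂ) : Matrix (Fin N) (Fin N) ℂ) *
            weightedStapleSum w (fundamentalRep (Fin N)) U e.1 e.2).trace).re -
        ((exp (t • sunCoordι N c) * ((((U e : Matrix.specialUnitaryGroup (Fin N) ℂ) : Matrix (Fin N) (Fin N) ℂ) *
            weightedStapleSum w (fundamentalRep (Fin N)) U e.1 e.2))).trace).re) := by
  have h := weightedWilsonAction_mulSingle_sub w (fundamentalRep (Fin N)) hL (continuous_fundamentalRep (Fin N)) U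
    e.1 e.2 (suExp (sunCoordι N) (sunCoordι_skew N) (t • c))
  rw [Prod.mk.eta, fundamentalRep_apply, fundamentalRep_apply, WilsonFlow.coe_mul_SU, coe_suExp,
    LinearMap.map_smul, Matrix.mul_assoc] at h
  congr 1
  linarith

end Drift

/-! ## §2 The weighted force is the exact gradient -/

section Gradient

variable (N : ℕ) [NeZero N] {d L : ℕ} [NeZero L] (w : Plaquette d L → ℝ)

/-- **THE PLAQUETTE-WEIGHTED `SU(N)` FORCE IS THE EXACT DERIVATIVE OF THE WEIGHTED ACTION ALONG THE DRIFT.**  Torus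
`(ℤ/L)^d` with `L ≥ 2`, `N ≥ 1`, any real `β`, ANY weights `w`, any configuration `U`, link `e`, coordinate vector
`c` (`X = ι c`): `t ↦ (β/N)·S_w(e^{tX} ·_e U)` has derivative `−2 Re tr (X · (β/2N)·TA(U_e R^w_e(U)))` at `t = 0` — the
weighted-staple force matrix is the molecular-dynamics force of `H = −Σ tr P_e² + (β/N)·S_w`. -/
theorem hasDerivAt_engineWeightedAction_drift (hL : 2 ≤ L) (β : ℝ)
    (U : GaugeConfig d L (Matrix.specialUnitaryGroup (Fin N) ℂ)) (e : Edge d L) (c : SUNCoords N) :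
    HasDerivAt (fun t : ℝ => β / N * weightedWilsonAction w (fundamentalRep (Fin N))
        (Pi.mulSingle e (suExp (sunCoordι N) (sunCoordι_skew N) (t • c)) * U))
      (-2 * ((sunCoordι N c * ((β / (2 * N)) • suProj
        (((U e : Matrix.specialUnitaryGroup (Fin N) ℂ) : Matrix (Fin N) (Fin N) ℂ) *
          weightedStapleSum w (fundamentalRep (Fin N)) U e.1 e.2))).trace).re) 0 := by
  have hfun : (fun t : ℝ => β / N * weightedWilsonAction w (fundamentalRep (Fin N))
        (Pi.mulSingle e (suExp (sunCoordι N) (sunCoordι_skew N) (t • c)) * U)) =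
      fun t : ℝ => β / N * (weightedWilsonAction w (fundamentalRep (Fin N)) U +
        ((((U e : Matrix.specialUnitaryGroup (Fin N) ℂ) : Matrix (Fin N) (Fin N) ℂ) *
            weightedStapleSum w (fundamentalRep (Fin N)) U e.1 e.2).trace).re -
        ((exp (t • sunCoordι N c) * ((((U e : Matrix.specialUnitaryGroup (Fin N) ℂ) : Matrix (Fin N) (Fin N) ℂ) *
            weightedStapleSum w (fundamentalRep (Fin N)) U e.1 e.2))).trace).re) :=
    funext fun t => engineWeightedAction_mulSingle_suExp N w hL β U e c t
  rw [hfun, ← engineForce_deriv_value N (sunCoordι_skew N c).1 (sunCoordι_skew N c).2 β]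
  exact ((hasDerivAt_const (0 : ℝ) _).sub (hasDerivAt_re_trace_exp_smul_mul _ _ 0)).const_mul (β / N)

/-- **THE OPEN-BOUNDARY INSTANCE**: for `S_OBC = S_{obcWeight τ}` (time direction `τ`), the open-boundary force matrix
`(β/2N)·TA(U_e R^{obc}_e(U))` is the exact gradient of `(β/N)·S_OBC` along every drift. -/
theorem hasDerivAt_engineObcAction_drift (hL : 2 ≤ L) (τ : Fin d) (β : ℝ)
    (U : GaugeConfig d L (Matrix.specialUnitaryGroup (Fin N) ℂ)) (e : Edge d L) (c : SUNCoords N) :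
    HasDerivAt (fun t : ℝ => β / N * obcAction (fundamentalRep (Fin N)) τ
        (Pi.mulSingle e (suExp (sunCoordι N) (sunCoordι_skew N) (t • c)) * U))
      (-2 * ((sunCoordι N c * ((β / (2 * N)) • suProj
        (((U e : Matrix.specialUnitaryGroup (Fin N) ℂ) : Matrix (Fin N) (Fin N) ℂ) *
          weightedStapleSum (obcWeight τ) (fundamentalRep (Fin N)) U e.1 e.2))).trace).re) 0 :=
  hasDerivAt_engineWeightedAction_drift N (obcWeight τ) hL β U e c

end Gradient

end Summit.Ventures.LatticeQCDFlow.Exactness
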